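import Mathlib.Algebra.Polynomial.Roots
import Mathlib.Analysis.Complex.Exponential
import Mathlib.RingTheory.HopkinsLevitzki
import Mathlib.RingTheory.KrullDimension.Field
import Mathlib.RingTheory.KrullDimension.Polynomial
import Literature.NumberTheory.Transcendental.ZilberField
import HarnessLib

/-!
# The diagonal test curve for (strong) exponential-algebraic closedness; `ℝ_exp` fails EAC

`Literature.IsExpAlgClosed K` (EAC) and `Literature.IsStronglyExpAlgClosed K` (SEAC; Zilber 2005 §1, axiom
(SEC); Kirby 2013 §2, axiom 4: "if `V` is a rotund, additively and multiplicatively free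
subvariety of `𝔾ₐⁿ × 𝔾ₘⁿ` defined over `F` and of dimension `n`, and `ā` is a finite tuple from `F`,
then there is `x̄` in `F` such that `(x̄, e^x̄) ∈ V` and is generic in `V` over `ā`") are *axioms*
on an exponential field `K` — predicates in `K`, not theorems. This file works out the simplest
admissible instance of both axioms, over an **arbitrary** field of characteristic zero (no
algebraic closedness, so that it applies to `ℝ`), and draws the consequences:

* `Literature.diagLine K`: the diagonal `Δ = {(x, y) | y = x} ⊆ K × K ⊇ G¹ = K × Kˣ` (`n = 1`), the
  curve `p(x, y) = y - x = 0`. In one variable the varieties admissible in SEAC are the curves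
  `p(x, eˣ) = 0` with `p` irreducible in which both variables appear (Mantova–Zannier 2016, §1,
  before Conjecture 1.1); `y - x` is the simplest.
* `Literature.NumberTheory.Transcendental.isIrreducibleClosed_diagLine`, `Literature.NumberTheory.Transcendental.diagLine_inter_torusLocus_nonempty`,
  `Literature.NumberTheory.Transcendental.isRotund_diagLine`, `Literature.NumberTheory.Transcendental.isAddFree_diagLine`, `Literature.NumberTheory.Transcendental.isMulFree_diagLine`,
  `Literature.NumberTheory.Transcendental.zariskiDim_diagLine`, `Literature.NumberTheory.Transcendental.isDefinedOver_diagLine`: in characteristic zero, `Δ` satisfies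
  **every hypothesis** of `IsExpAlgClosed`/`IsStronglyExpAlgClosed` (so the axioms are not
  vacuous for the vocabulary of `ExpVarieties.lean`: `IsRotund`, `IsAddFree`, `IsMulFree`,
  `zariskiDim`, `IsIrreducibleClosed`, `IsDefinedOver`, `IsGenericOver`).
* `Literature.NumberTheory.Transcendental.IsExpAlgClosed.exists_exp_eq_self`: EAC gives a fixed point `exp x = x`;
  `Literature.NumberTheory.Transcendental.IsStronglyExpAlgClosed.exists_exp_eq_self_transcendental`: SEAC gives, for every finite
  `A ⊆ K`, a fixed point transcendental over `ℚ(A)` — the case `p = y - x` of the one-variable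
  strong exponential closedness "for any finitely generated `k` and irreducible `p ∈ k[x, y]` with
  `∂p/∂x, ∂p/∂y ≠ 0` there is `z` with `p(z, exp z) = 0` and `td_k(z, exp z) = 1`"
  (Mantova–Zannier 2016, Conjecture 1.1, stated there for `ℂ` after Zilber 2005).
* `Literature.NumberTheory.Transcendental.not_isExpAlgClosed_real`, `Literature.NumberTheory.Transcendental.not_isLinIndepExpAlgClosed_real`,
  `Literature.NumberTheory.Transcendental.not_isStronglyExpAlgClosed_real`, `Literature.NumberTheory.Transcendental.not_isZilberField_real`,
  `Literature.NumberTheory.Transcendental.not_forall_isStronglyExpAlgClosed`: the real exponential field `(ℝ, Real.exp)`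
  (`Literature.ModelTheory.ExponentialFields.Real.instExponentialRing`) fails EAC since `eˣ ≥ x + 1 > x` (Mathlib
  `Real.add_one_le_exp`), hence fails SEAC, Kirby's scheme `IsLinIndepExpAlgClosed` and Zilber's
  axioms. Consequently there is no closed proof term of type
  `∀ K, IsStronglyExpAlgClosed K`: SEAC is an axiom satisfied by Zilber fields (and conjecturally
  by `ℂ_exp`, Zilber's conjecture), refuted by `ℝ_exp`.
* Tools, valid over any field: `Literature.NumberTheory.Transcendental.zariskiDim_nonneg` (nonempty sets have dimension `≥ 0`) and
  `Literature.NumberTheory.Transcendental.one_le_zariskiDim_of_infinite` — an infinite subset of affine `ι`-space (`ι` finite) has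
  Zariski dimension `≥ 1`: otherwise its coordinate ring is Noetherian of dimension `0`, hence
  Artinian (Stacks 00KH, Mathlib `isArtinianRing_iff_isNoetherianRing_krullDimLE_zero`) with
  finitely many maximal ideals (Stacks 00J7, Mathlib `IsArtinianRing.setOf_isMaximal_finite`),
  while distinct points give distinct maximal ideals `𝔪_a ⊇ I(S)`.

The dimension toolkit of `ExpVarietiesDimension.lean` (generic points, transcendence degree)
assumes `K` algebraically closed and is not used: for `n = 1` rotundity reduces to "the image
`{(mt, tᵐ) | t ≠ 0}` of `Δ ∩ G¹` under `[m]`, `m ≠ 0`, is infinite".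

## References

* V. Mantova (with an appendix by V. Mantova and U. Zannier), *Polynomial-exponential equations
  and Zilber's conjecture*, Bull. London Math. Soc. 48 (2016) 309–320 (arXiv:1402.0685), §1,
  Conjecture 1.1.
* J. Kirby, *A note on the axioms for Zilber's pseudo-exponential fields*, Notre Dame J. Formal
  Logic 54 (2013) 509–520 (arXiv:1006.0894), §2, axiom 4.
* B. Zilber, *Pseudo-exponentiation on algebraically closed fields of characteristic zero*,
  Ann. Pure Appl. Logic 132 (2005) 67–95, §1.
* The Stacks project, Tags 00KH, 00J7.
-/

noncomputable section

open MvPolynomial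

namespace Literature.NumberTheory.Transcendental

section KrullDim

variable (K : Type*) [Field K] {ι : Type*}

/-- A nonempty subset of affine space has Zariski dimension `≥ 0` (its coordinate ring is
nonzero). [folklore] -/
theorem zariskiDim_nonneg {S : Set (ι → K)} (hS : S.Nonempty) : 0 ≤ zariskiDim K S := by
  obtain ⟨a, ha⟩ := hS
  have hne : MvPolynomial.vanishingIdeal K S ≠ ⊤ := by
    intro htop
    have h1 : (1 : MvPolynomial ι K) ∈ MvPolynomial.vanishingIdeal K S := htop ▸ Submodule.mem_top
    have := (MvPolynomial.mem_vanishingIdeal_iff.mp h1) a ha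
    simp at this
  haveI : Nontrivial (MvPolynomial ι K ⧸ MvPolynomial.vanishingIdeal K S) :=
    Ideal.Quotient.nontrivial_iff.mpr hne
  exact ringKrullDim_nonneg_of_nontrivial

variable [Finite ι]

/-- **An infinite subset of affine `ι`-space (`ι` finite) has Zariski dimension `≥ 1`.** If the
coordinate ring `K[X_ι] ⧸ I(S)` had dimension `≤ 0` it would be a zero-dimensional Noetherian
ring, hence Artinian (Stacks 00KH) with finitely many maximal ideals (Stacks 00J7); but the
points `a ∈ S` give pairwise distinct maximal ideals `𝔪_a = I({a}) ⊇ I(S)`. [folklore] -/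
theorem one_le_zariskiDim_of_infinite {S : Set (ι → K)} (hS : S.Infinite) :
    1 ≤ zariskiDim K S := by
  classical
  by_contra hlt
  set I : Ideal (MvPolynomial ι K) := MvPolynomial.vanishingIdeal K S with hI
  -- Krull dimension `≤ 0`
  have h0 : ringKrullDim (MvPolynomial ι K ⧸ I) ≤ 0 := by
    have h' : ¬ (1 : WithBot ℕ∞) ≤ ringKrullDim (MvPolynomial ι K ⧸ I) := hlt
    revert h'
    generalize ringKrullDim (MvPolynomial ι K ⧸ I) = d
    intro h'
    induction d using WithBot.recBotCoe with
    | bot => exact bot_le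
    | coe d =>
      have hd : d < 1 := by
        by_contra hd
        exact h' (WithBot.coe_le_coe.mpr (not_lt.mp hd))
      exact WithBot.coe_le_coe.mpr (Order.lt_one_iff.mp hd).le
  haveI : Ring.KrullDimLE 0 (MvPolynomial ι K ⧸ I) :=
    Ring.krullDimLE_iff.mpr (by exact_mod_cast h0)
  haveI : IsArtinianRing (MvPolynomial ι K ⧸ I) :=
    isArtinianRing_iff_isNoetherianRing_krullDimLE_zero.mpr ⟨inferInstance, inferInstance⟩
  have hfin := IsArtinianRing.setOf_isMaximal_finite (MvPolynomial ι K ⧸ I)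
  -- points of `S` give pairwise distinct maximal ideals of the coordinate ring
  let f : (ι → K) → Ideal (MvPolynomial ι K ⧸ I) := fun a =>
    (MvPolynomial.vanishingIdeal K {a}).map (Ideal.Quotient.mk I)
  have hle : ∀ a ∈ S, I ≤ MvPolynomial.vanishingIdeal K {a} := fun a ha =>
    MvPolynomial.vanishingIdeal_anti_mono (Set.singleton_subset_iff.mpr ha)
  have hmax : ∀ a ∈ S, (f a).IsMaximal := by
    intro a ha
    refine Ideal.IsMaximal.map_of_surjective_of_ker_le Ideal.Quotient.mk_surjective ?_
    rw [Ideal.mk_ker]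
    exact hle a ha
  have hinj : Set.InjOn f S := by
    intro a ha b hb hab
    have hc : ∀ c ∈ S, (f c).comap (Ideal.Quotient.mk I) = MvPolynomial.vanishingIdeal K {c} := by
      intro c hc
      simp only [f]
      rw [Ideal.comap_map_of_surjective' _ Ideal.Quotient.mk_surjective, Ideal.mk_ker,
        sup_eq_left.mpr (hle c hc)]
    have hab' : MvPolynomial.vanishingIdeal K {a} = MvPolynomial.vanishingIdeal K {b} := by
      rw [← hc a ha, ← hc b hb, hab]
    funext i
    have hi : (X i - C (a i) : MvPolynomial ι K) ∈ MvPolynomial.vanishingIdeal K {a} := by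
      rw [MvPolynomial.mem_vanishingIdeal_singleton_iff]
      simp
    rw [hab', MvPolynomial.mem_vanishingIdeal_singleton_iff] at hi
    simp only [map_sub, aeval_X, aeval_C] at hi
    exact (sub_eq_zero.mp hi).symm
  refine hS (Set.Finite.of_finite_image (hfin.subset ?_) hinj)
  rintro _ ⟨a, ha, rfl⟩
  exact hmax a ha

end KrullDim

/-! ### The diagonal `y = x` in `K × K` -/

section Diagonal

variable (K : Type*)

/-- The diagonal test curve `Δ = {(x, y) ∈ K × K | y = x}` in `K^{1 ⊕ 1} ⊇ G¹ = K × Kˣ`: the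
curve `p(x, y) = 0` for `p = Y - X`, an instance of the curves "`p ∈ k[x, y]` irreducible with
`∂p/∂x, ∂p/∂y ≠ 0`" of the one-variable case of Zilber's strong exponential closedness
(Mantova–Zannier 2016, §1, Conjecture 1.1). [folklore] -/
def diagLine : Set (Fin 1 ⊕ Fin 1 → K) :=
  {z | z (Sum.inr 0) = z (Sum.inl 0)}

variable {K}

/-- Membership in the diagonal. [folklore] -/
@[simp] theorem mem_diagLine_iff {z : Fin 1 ⊕ Fin 1 → K} :
    z ∈ diagLine K ↔ z (Sum.inr 0) = z (Sum.inl 0) :=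
  Iff.rfl

/-- The point `(t, t)` of `K^{1 ⊕ 1}`. [folklore] -/
def diagPt (t : K) : Fin 1 ⊕ Fin 1 → K := fun _ => t

/-- Coordinates of `(t, t)`. [folklore] -/
@[simp] theorem diagPt_apply (t : K) (i : Fin 1 ⊕ Fin 1) : diagPt t i = t := rfl

/-- `(t, t) ∈ Δ`. [folklore] -/
theorem diagPt_mem_diagLine (t : K) : diagPt t ∈ diagLine K := rfl

/-- A point of the diagonal is `(t, t)` with `t` its additive coordinate. [folklore] -/
theorem eq_diagPt_of_mem_diagLine {z : Fin 1 ⊕ Fin 1 → K} (hz : z ∈ diagLine K) :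
    z = diagPt (z (Sum.inl 0)) := by
  funext i
  rcases i with i | i
  · rw [Subsingleton.elim i 0]; rfl
  · rw [Subsingleton.elim i 0]; exact hz

/-- `Δ` is the image of `t ↦ (t, t)`. [folklore] -/
theorem diagLine_eq_range : diagLine K = Set.range (diagPt : K → Fin 1 ⊕ Fin 1 → K) := by
  ext z
  exact ⟨fun hz => ⟨z (Sum.inl 0), (eq_diagPt_of_mem_diagLine hz).symm⟩,
    fun ⟨t, ht⟩ => ht ▸ diagPt_mem_diagLine t⟩

/-- `t ↦ (t, t)` is injective. [folklore] -/
theorem diagPt_injective : Function.Injective (diagPt : K → Fin 1 ⊕ Fin 1 → K) :=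
  fun s t h => by simpa using congr_fun h (Sum.inl 0)

/-- `Δ` is infinite over an infinite field. [folklore] -/
theorem diagLine_infinite [Infinite K] : (diagLine K).Infinite := by
  rw [diagLine_eq_range]
  exact Set.infinite_range_of_injective diagPt_injective

variable [Field K]

/-- `(t, t) ∈ G¹ = K × Kˣ` iff `t ≠ 0`. [folklore] -/
theorem diagPt_mem_torusLocus_iff {t : K} : diagPt t ∈ torusLocus K 1 ↔ t ≠ 0 := by
  simp [mem_torusLocus_iff]

/-- `Δ` is defined over every subfield (by `Y - X`, coefficients `±1`); in particular over `ℚ`.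
[folklore] -/
theorem isDefinedOver_diagLine (L : Subfield K) : IsDefinedOver L (diagLine K) := by
  refine ⟨Ideal.span {X (Sum.inr 0) - X (Sum.inl 0)}, ?_⟩
  rw [MvPolynomial.zeroLocus_span]
  ext z
  simp [sub_eq_zero]

/-- `Δ` is Zariski closed. [folklore] -/
theorem isZariskiClosed_diagLine : IsZariskiClosed K (diagLine K) := by
  refine ⟨Ideal.span {X (Sum.inr 0) - X (Sum.inl 0)}, ?_⟩
  rw [MvPolynomial.zeroLocus_span]
  ext z
  simp [sub_eq_zero]

/-- The substitution `X, Y ↦ T`: restriction of a polynomial on `K × K` to the diagonal, as a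
one-variable polynomial. [folklore] -/
def diagSubst (L : Type*) [CommRing L] : MvPolynomial (Fin 1 ⊕ Fin 1) L →ₐ[L] Polynomial L :=
  MvPolynomial.aeval fun _ => Polynomial.X

/-- `(p|_Δ)(t) = p(t, t)`. [folklore] -/
theorem eval_diagSubst {L : Type*} [Field L] [Algebra L K] (p : MvPolynomial (Fin 1 ⊕ Fin 1) L)
    (t : K) : Polynomial.aeval t (diagSubst L p) = MvPolynomial.aeval (diagPt t) p := by
  unfold diagSubst
  rw [MvPolynomial.comp_aeval_apply]
  simp only [Polynomial.aeval_X]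
  rfl

/-- **The ideal of the diagonal is the kernel of `X, Y ↦ T`** (over an infinite field): a
polynomial vanishes on `Δ(K)` iff its restriction `p(T, T)` is the zero polynomial. [folklore] -/
theorem vanishingIdeal_diagLine [Infinite K] {L : Type*} [Field L] [Algebra L K] :
    MvPolynomial.vanishingIdeal L (diagLine K) = RingHom.ker (diagSubst L) := by
  ext p
  rw [MvPolynomial.mem_vanishingIdeal_iff, RingHom.mem_ker]
  constructor
  · intro h
    have h' : (diagSubst L p).map (algebraMap L K) = 0 := by
      refine Polynomial.funext fun t => ?_
      rw [Polynomial.eval_map_algebraMap, eval_diagSubst, Polynomial.eval_zero]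
      exact h _ (diagPt_mem_diagLine t)
    exact (Polynomial.map_eq_zero_iff (algebraMap L K).injective).mp h'
  · intro h z hz
    rw [eq_diagPt_of_mem_diagLine hz, ← eval_diagSubst, h, map_zero]

/-- `Δ` is an irreducible Zariski closed subset of `K × K` (its ideal is the prime kernel of
`K[X, Y] → K[T]`). [folklore] -/
theorem isIrreducibleClosed_diagLine [Infinite K] : IsIrreducibleClosed K (diagLine K) := by
  refine ⟨isZariskiClosed_diagLine, ?_⟩
  rw [vanishingIdeal_diagLine]
  exact RingHom.ker_isPrime _

/-- `Δ ∩ G¹ ≠ ∅`: it contains `(1, 1)`. [folklore] -/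
theorem diagLine_inter_torusLocus_nonempty : (diagLine K ∩ torusLocus K 1).Nonempty :=
  ⟨diagPt 1, diagPt_mem_diagLine 1, diagPt_mem_torusLocus_iff.mpr one_ne_zero⟩

/-- **`dim Δ = 1`**: `≥ 1` as `Δ` is infinite (`one_le_zariskiDim_of_infinite`); `≤ 1` because
`T ↦ X` induces a surjection `K[T] ↠ K[X, Y]/I(Δ)` and `dim K[T] = 1`. [folklore] -/
theorem zariskiDim_diagLine [Infinite K] : zariskiDim K (diagLine K) = 1 := by
  refine le_antisymm ?_ (one_le_zariskiDim_of_infinite K diagLine_infinite)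
  unfold zariskiDim
  set I := MvPolynomial.vanishingIdeal K (diagLine K) with hI
  -- the surjection `K[T] → K[X, Y] ⧸ I(Δ)`, `T ↦ X`
  let ψ : Polynomial K →ₐ[K] MvPolynomial (Fin 1 ⊕ Fin 1) K ⧸ I :=
    (Ideal.Quotient.mkₐ K I).comp (Polynomial.aeval (X (Sum.inl 0)))
  have hψ : Function.Surjective ψ := by
    intro r
    obtain ⟨p, rfl⟩ := Ideal.Quotient.mk_surjective r
    refine ⟨diagSubst K p, ?_⟩
    change Ideal.Quotient.mk I (Polynomial.aeval (X (Sum.inl 0)) (diagSubst K p)) =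
      Ideal.Quotient.mk I p
    rw [Ideal.Quotient.eq, hI, vanishingIdeal_diagLine, RingHom.mem_ker, map_sub, sub_eq_zero]
    -- `diagSubst (p(X, X)) = diagSubst p`
    have h1 : Polynomial.aeval (X (Sum.inl 0) : MvPolynomial (Fin 1 ⊕ Fin 1) K) (diagSubst K p) =
        MvPolynomial.aeval (fun _ => X (Sum.inl 0)) p := by
      unfold diagSubst
      rw [MvPolynomial.comp_aeval_apply]
      simp only [Polynomial.aeval_X]
    rw [h1]
    unfold diagSubst
    rw [MvPolynomial.comp_aeval_apply]
    simp only [MvPolynomial.aeval_X]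
  calc ringKrullDim (MvPolynomial (Fin 1 ⊕ Fin 1) K ⧸ I)
      ≤ ringKrullDim (Polynomial K) := ringKrullDim_le_of_surjective ψ.toRingHom hψ
    _ = 1 := by
      rw [Polynomial.ringKrullDim_of_isNoetherianRing, ringKrullDim_eq_zero_of_field K, zero_add]

variable [CharZero K]

/-- **`Δ ∩ G¹` is rotund**: for `M = (m)`, `m ≠ 0`, the image `{(mt, tᵐ) | t ≠ 0}` is infinite
(its first coordinate is injective in `t`), so of dimension `≥ 1 = rk M`; for `m = 0` the rank
is `0`. [folklore] -/
theorem isRotund_diagLine : IsRotund K 1 (diagLine K ∩ torusLocus K 1) := by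
  intro M
  by_cases hm : M 0 0 = 0
  · have hM : M = 0 := by
      ext i j
      rw [Subsingleton.elim i 0, Subsingleton.elim j 0, hm]
      rfl
    rw [hM, Matrix.map_zero _ (Int.cast_zero : ((0 : ℤ) : ℚ) = 0), Matrix.rank_zero, Nat.cast_zero]
    exact zariskiDim_nonneg K (diagLine_inter_torusLocus_nonempty.image _)
  · -- the image is infinite
    have hinf : (matrixAct M '' (diagLine K ∩ torusLocus K 1)).Infinite := by
      have hsub : (fun t => matrixAct M (diagPt t)) '' ({0}ᶜ : Set K) ⊆
          matrixAct M '' (diagLine K ∩ torusLocus K 1) := by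
        rintro _ ⟨t, ht, rfl⟩
        exact ⟨diagPt t, ⟨diagPt_mem_diagLine t, diagPt_mem_torusLocus_iff.mpr ht⟩, rfl⟩
      refine Set.Infinite.mono hsub (Set.Infinite.image ?_ (Set.finite_singleton 0).infinite_compl)
      intro s _ t _ hst
      have h := congr_fun hst (Sum.inl 0)
      simp only [matrixAct_inl, diagPt_apply, Fin.sum_univ_one] at h
      exact mul_left_cancel₀ (Int.cast_ne_zero.mpr hm) h
    calc (((M.map (Int.cast : ℤ → ℚ)).rank : ℕ) : WithBot ℕ∞) ≤ (1 : ℕ) := by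
          exact_mod_cast Matrix.rank_le_width _
      _ ≤ zariskiDim K (matrixAct M '' (diagLine K ∩ torusLocus K 1)) :=
          one_le_zariskiDim_of_infinite K hinf

/-- **`Δ ∩ G¹` is additively free**: `m·x` (`m ≠ 0`) takes the distinct values `m, 2m` at
`(1, 1), (2, 2)`. [folklore] -/
theorem isAddFree_diagLine : IsAddFree K 1 (diagLine K ∩ torusLocus K 1) := by
  rintro m hm ⟨c, hc⟩
  have h1 := hc (diagPt 1) ⟨diagPt_mem_diagLine 1, diagPt_mem_torusLocus_iff.mpr one_ne_zero⟩
  have h2 := hc (diagPt 2) ⟨diagPt_mem_diagLine 2, diagPt_mem_torusLocus_iff.mpr two_ne_zero⟩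
  simp only [Fin.sum_univ_one, diagPt_apply, mul_one] at h1 h2
  have h0 : (m 0 : K) = 0 := by
    have h12 : (m 0 : K) * 2 = (m 0 : K) := h2.trans h1.symm
    have : (m 0 : K) * 2 - (m 0 : K) = (m 0 : K) := by ring
    rw [h12, sub_self] at this
    exact this.symm
  refine hm (funext fun i => ?_)
  rw [Subsingleton.elim i 0, Pi.zero_apply]
  exact_mod_cast h0

/-- In characteristic zero, `2 ^ n = 1` forces `n = 0` (`n ∈ ℤ`). [folklore] -/
theorem two_zpow_eq_one_iff {n : ℤ} : (2 : K) ^ n = 1 ↔ n = 0 := by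
  refine ⟨fun h => ?_, fun h => by rw [h, zpow_zero]⟩
  have key : ∀ k : ℕ, (2 : K) ^ k = 1 → k = 0 := by
    intro k hk
    have hk' : ((2 ^ k : ℕ) : K) = ((1 : ℕ) : K) := by push_cast; exact hk
    have hk'' := Nat.cast_injective hk'
    by_contra hk0
    exact absurd hk'' (Nat.one_lt_two_pow hk0).ne'
  rcases Int.natAbs_eq n with hn | hn
  · rw [hn, zpow_natCast] at h
    rw [hn, key _ h, Nat.cast_zero]
  · rw [hn, zpow_neg, zpow_natCast, inv_eq_one] at h
    rw [hn, key _ h, Nat.cast_zero, neg_zero]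

/-- **`Δ ∩ G¹` is multiplicatively free**: `yᵐ` (`m ≠ 0`) takes the distinct values `1, 2ᵐ` at
`(1, 1), (2, 2)`. [folklore] -/
theorem isMulFree_diagLine : IsMulFree K 1 (diagLine K ∩ torusLocus K 1) := by
  rintro m hm ⟨c, hc⟩
  have h1 := hc (diagPt 1) ⟨diagPt_mem_diagLine 1, diagPt_mem_torusLocus_iff.mpr one_ne_zero⟩
  have h2 := hc (diagPt 2) ⟨diagPt_mem_diagLine 2, diagPt_mem_torusLocus_iff.mpr two_ne_zero⟩
  simp only [Fin.prod_univ_one, diagPt_apply, one_zpow] at h1 h2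
  rw [← h1, two_zpow_eq_one_iff] at h2
  refine hm (funext fun i => ?_)
  rw [Subsingleton.elim i 0, Pi.zero_apply, h2]

end Diagonal

/-! ### Consequences of EAC and SEAC for the diagonal -/

section Consequences

variable {K : Type*} [Field K] [CharZero K] [Literature.ModelTheory.ExponentialFields.ExponentialRing K]

/-- **EAC forces a fixed point of `exp`**: applying exponential-algebraic closedness to the
diagonal `Δ` (admissible by `isIrreducibleClosed_diagLine`, `isRotund_diagLine`,
`isAddFree_diagLine`, `isMulFree_diagLine`, `zariskiDim_diagLine`) gives `x` with `exp x = x`: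
the case `p = y - x` of the one-variable solvability "`p(z, exp z) = 0` has (infinitely many)
solutions" (Mantova–Zannier 2016, §1, for `ℂ`; here one solution, in any model of EAC).
[cite: MantovaZannier2016, §1 (one-variable case, p = y - x)] -/
theorem IsExpAlgClosed.exists_exp_eq_self (h : IsExpAlgClosed K) :
    ∃ x : K, Literature.ModelTheory.ExponentialFields.ExponentialRing.exp x = x := by
  obtain ⟨z, hzW, hzexp⟩ := h 1 (diagLine K) isIrreducibleClosed_diagLine
    diagLine_inter_torusLocus_nonempty isRotund_diagLine isAddFree_diagLine isMulFree_diagLine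
    zariskiDim_diagLine
  exact ⟨z (Sum.inl 0), ((mem_expGraph_iff.mp hzexp) 0).symm.trans hzW⟩

/-- **SEAC forces generic fixed points of `exp`**: for every finite `A ⊆ K` there is `x` with
`exp x = x` transcendental over `ℚ(A)` — the case `p = y - x` of Zilber's one-variable strong
exponential closedness "for any finitely generated `k` and irreducible `p(x, y) ∈ k[x, y]` with
`∂p/∂x, ∂p/∂y ≠ 0` there is `z` with `p(z, exp z) = 0` and `td_k(z, exp z) = 1`"
(Mantova–Zannier 2016, Conjecture 1.1, stated for `ℂ` after Zilber 2005).
[cite: MantovaZannier2016, Conjecture 1.1 (case p = y - x)] -/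
theorem IsStronglyExpAlgClosed.exists_exp_eq_self_transcendental (h : IsStronglyExpAlgClosed K)
    (A : Finset K) :
    ∃ x : K, Literature.ModelTheory.ExponentialFields.ExponentialRing.exp x = x ∧ Transcendental (Subfield.closure (A : Set K)) x := by
  obtain ⟨z, ⟨hzW, hzexp⟩, hgen⟩ := h 1 (diagLine K) isIrreducibleClosed_diagLine
    diagLine_inter_torusLocus_nonempty isRotund_diagLine isAddFree_diagLine isMulFree_diagLine
    zariskiDim_diagLine A ∅ (isDefinedOver_diagLine _)
  rw [Finset.coe_empty, Set.union_empty] at hgen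
  set L : Subfield K := Subfield.closure (A : Set K)
  refine ⟨z (Sum.inl 0), ((mem_expGraph_iff.mp hzexp) 0).symm.trans hzW, ?_⟩
  rintro ⟨q, hq0, hqz⟩
  apply hq0
  -- `q(X) ∈ L[X, Y]` vanishes at the `L`-generic point `z = (x, x)`, hence on `Δ`
  set Q : MvPolynomial (Fin 1 ⊕ Fin 1) L := Polynomial.aeval (X (Sum.inl 0)) q with hQ
  have hQeval : ∀ w : Fin 1 ⊕ Fin 1 → K,
      MvPolynomial.aeval w Q = Polynomial.aeval (w (Sum.inl 0)) q := by
    intro w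
    rw [hQ, ← Polynomial.aeval_algHom_apply, MvPolynomial.aeval_X]
  have hQz : Q ∈ MvPolynomial.vanishingIdeal L ({z} : Set (Fin 1 ⊕ Fin 1 → K)) := by
    rw [MvPolynomial.mem_vanishingIdeal_singleton_iff, hQeval]
    exact hqz
  rw [hgen.2, MvPolynomial.mem_vanishingIdeal_iff] at hQz
  have hq : q.map (algebraMap L K) = 0 := by
    refine Polynomial.funext fun t => ?_
    rw [Polynomial.eval_map_algebraMap, Polynomial.eval_zero, ← diagPt_apply t (Sum.inl 0),
      ← hQeval]
    exact hQz _ (diagPt_mem_diagLine t)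
  exact (Polynomial.map_eq_zero_iff (algebraMap L K).injective).mp hq

end Consequences

/-! ### The real exponential field -/

section Real

/-- `eˣ ≠ x` for real `x`, since `eˣ ≥ x + 1` (Mathlib `Real.add_one_le_exp`). [folklore] -/
theorem real_exp_ne_self (x : ℝ) : Real.exp x ≠ x := by
  have h := Real.add_one_le_exp x
  intro hx
  rw [hx] at h
  linarith

/-- **`ℝ_exp` is not exponentially-algebraically closed**: the admissible curve `y = x` misses
the graph of `exp` (`eˣ > x`). Hence EAC is a genuine axiom, not a theorem about exponential
fields. [folklore] -/
theorem not_isExpAlgClosed_real : ¬ IsExpAlgClosed ℝ := fun h => by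
  obtain ⟨x, hx⟩ := h.exists_exp_eq_self
  exact real_exp_ne_self x hx

/-- **`ℝ_exp` does not satisfy Kirby's linear-independence scheme** (it implies EAC,
`IsLinIndepExpAlgClosed.isExpAlgClosed`). [folklore] -/
theorem not_isLinIndepExpAlgClosed_real : ¬ IsLinIndepExpAlgClosed ℝ := fun h =>
  not_isExpAlgClosed_real h.isExpAlgClosed

/-- **`ℝ_exp` is not strongly exponentially-algebraically closed** (SEAC implies EAC,
`IsStronglyExpAlgClosed.isExpAlgClosed`). In particular Zilber's axiom
`Literature.IsStronglyExpAlgClosed K` is refutable for some exponential field of characteristic zero: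
it is an axiom (satisfied by Zilber fields, conjecturally by `ℂ_exp`), not a theorem. [folklore] -/
theorem not_isStronglyExpAlgClosed_real : ¬ IsStronglyExpAlgClosed ℝ := fun h =>
  not_isExpAlgClosed_real h.isExpAlgClosed

/-- **`ℝ_exp` is not a Zilber field** (via SEAC; it is of course not even algebraically
closed). [folklore] -/
theorem not_isZilberField_real : ¬ IsZilberField ℝ := fun h =>
  not_isStronglyExpAlgClosed_real h.isStronglyExpAlgClosed

/-- Zilber's axiom SEAC, read as a closed statement "every exponential field of characteristic
zero is strongly exponentially-algebraically closed", is **false** (witness `ℝ_exp`). [folklore] -/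
theorem not_forall_isStronglyExpAlgClosed :
    ¬ ∀ (K : Type) [Field K] [CharZero K] [Literature.ModelTheory.ExponentialFields.ExponentialRing K], IsStronglyExpAlgClosed K :=
  fun h => not_isStronglyExpAlgClosed_real (h ℝ)

end Real

end Literature.NumberTheory.Transcendental
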